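import Mathlib

/-!
# Solo-blind seat (MatrixMultiplication), s71 — frame certificates for Conjecture G (paper/KraftK3.md §7.11, CLAIMS c699)

Background (door I1⁗ / the Kraft inequality (K₃), see `SoloBlindFibreCap`, `SoloBlindTightTwisted`): CONJECTURE G says that every
anisotropic quadratic map `Q : 𝔽₃ⁿ → 𝔽₃ʳ` has all level sets of size `≤ 2ⁿ`.  §7.11 reduces G to CONJECTURE Φ: every such level set `A` is
GOOD IN SOME FRAME, i.e. for some `W ∈ GL_n(𝔽₃)` the `2ⁿ` multilinear monomials `∏_{i ∈ T} y_i` in the coordinates `y = W x` restrict to a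
spanning set of functions on `A` — equivalently the multilinear evaluation vectors `a ↦ (T ↦ ∏_{i∈T} (W a)_i)` are linearly independent.

This file is the kernel anchor of the counting half of that reduction, in full generality and over any field `K` and any coefficient map:
if the vectors `T ↦ ∏_{i ∈ T} y i a` (`T` ranging over `Finset (Fin n)`), `a ∈ A`, are linearly independent for SOME assignment of
coordinates `y : Fin n → α → K` (any nontrivial commutative ring `K`), then `|A| ≤ 2ⁿ` (`frameCertificate_card_le`).  No hypothesis on
`W` is needed for this direction (a non-invertible or even non-linear `y` only makes independence harder).  The instance used by §7.11
(`y i a = (W.mulVec a) i` over `ZMod 3`) is `goodFrame_card_le`.  Pure linear algebra; no `ω` content.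
-/

set_option linter.dupNamespace false
set_option autoImplicit false

namespace Summit.MatrixMultiplication.MatrixMultiplication.Theorems

open Finset

/-- FRAME CERTIFICATE (counting half of Φ ⟹ G), general form: if for some coordinate functions `y i : α → K` the multilinear
evaluation vectors `T ↦ ∏_{i ∈ T} y i a` of the points `a ∈ A` are linearly independent over a nontrivial commutative ring `K`,
then `|A| ≤ 2ⁿ`. -/
theorem frameCertificate_card_le {n : ℕ} {α K : Type*} [CommRing K] [StrongRankCondition K]
    (y : Fin n → α → K) (A : Finset α)
    (h : LinearIndependent K (fun a : A => fun T : Finset (Fin n) => ∏ i ∈ T, y i (a : α))) :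
    A.card ≤ 2 ^ n := by
  have h1 := h.fintype_card_le_finrank
  rw [Module.finrank_fintype_fun_eq_card, Fintype.card_finset, Fintype.card_fin] at h1
  simpa using h1

/-- GOOD IN SOME FRAME ⟹ `|A| ≤ 2ⁿ` (KraftK3 §7.11, (Φ2) over `𝔽₃`): if for a matrix `W` over `ZMod 3` the vectors
`T ↦ ∏_{i ∈ T} (W a)_i`, `a ∈ A ⊆ 𝔽₃ⁿ`, are linearly independent, then `A.card ≤ 2 ^ n` — the step by which Conjecture Φ implies
Conjecture G.  (Invertibility of `W` is not needed in this direction.) -/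
theorem goodFrame_card_le (n : ℕ) (W : Matrix (Fin n) (Fin n) (ZMod 3)) (A : Finset (Fin n → ZMod 3))
    (h : LinearIndependent (ZMod 3)
      (fun a : A => fun T : Finset (Fin n) => ∏ i ∈ T, (W.mulVec (a : Fin n → ZMod 3)) i)) :
    A.card ≤ 2 ^ n := by
  haveI : Fact (1 < 3) := ⟨by norm_num⟩
  exact frameCertificate_card_le (fun i (x : Fin n → ZMod 3) => (W.mulVec x) i) A h

end Summit.MatrixMultiplication.MatrixMultiplication.Theorems
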